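import Mathlib
import Summits.Ventures.HodgeRepro.Tier4.Line1.RTFSetting
import Summits.Ventures.HodgeRepro.Tier4.Line1.KernelNondegenerate
import Summits.Ventures.HodgeRepro.Tier4.Line1.LocallyCompactGA
import Summits.Ventures.HodgeRepro.Tier4.Line1.SecondCountableGA
import Summits.Ventures.HodgeRepro.Tier4.Line4.MaximalFamilyClosed
import Summits.Ventures.HodgeRepro.Tier4.Line4.IrreducibleSubspaceClosed

/-!
# Tier4/Line4/ClosedIrreducibleOfSetting — the wall's (4b)-CLOSED clause `h4bC` is a THEOREM on every setting

Blind re-derivation cell `pub-hodge-repro`, Tier 4 «prove the step» (README §9–§10), seat t4-L4-p2 (prover, LINE L4,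
gen 6).  Tree path `lean/Summits/Ventures/HodgeRepro/Tier4/Line4/ClosedIrreducibleOfSetting.lean`.  Mathlib-level glue of
two tree theorems; no literature, no definition, no instance.

WHAT IS PROVED.  The LINE L4 wall `mixed_two_torus_W3` / `mixed_two_torus` (Skeleton v0.44 L2260 / L2404) and display (4)
`l4_adaptedONB_closed` carry as their last binder the clause
`h4bC : ∀ V, S.IsInvariantSubspace V → (closed among continuous invariant functions) → (∃ ψ ∈ V, ∃ x, ψ x ≠ 0) →
  ∃ V', S.IsInvariantSubspace V' ∧ V' ⊆ V ∧ S.IsIrreducible V' ∧ (∃ ψ ∈ V', ∃ x, ψ x ≠ 0) ∧ IsClosedSub S V'`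
(the CLOSED form of L1's rung J1-(4b): every non-zero relatively closed invariant subspace contains a non-zero
relatively closed IRREDUCIBLE invariant subspace), displayed at `S := Setting.ofAdelicData (seesawPlane …) R μ DG fdG
compG compT compT'` and listed in the wall census §16 (C) as «an `L²`-spectral input, LIT-facing».  It is a theorem by
name on EVERY `S : RTF.Setting G` over a locally compact second countable `G`:
* `exists_irreducible_closedSub_of_invariant` — t4-L4-p1 g3's
  `exists_irreducible_invariant_subspace_closed_of_nondegenerate` (IrreducibleSubspaceClosed p686644: L1-p4's
  Deitmar–Echterhoff 9.2.7 construction with the closedness of `U*` exported) composed with t4-L1-p1's rung (4a)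
  `Setting.kernelOp_nondegenerate` (KernelNondegenerate p667389: the approximate identity) — the SAME composition
  L4-p1 g3 already uses inside `W3OfAdaptedClosed` (L184) and L1-p3 uses for the non-closed form in
  `DefinedContentOfData.exists_adaptedONB_ofData`;
* `h4bC_of_setting_GA` — its instance on any setting over `G(𝔸_k) = GA W` of a plane `W : PlaneData k`, the instances
  `LocallyCompactSpace (GA W)` / `SecondCountableTopology (GA W)` being L1-p5's `locallyCompact_GA` /
  `secondCountable_GA`.  The statement is the wall's `h4bC` binder VERBATIM with `S` free — so at the wall it is
  `h4bC_of_setting_GA (seesawPlane …) (Setting.ofAdelicData _ R μ DG fdG compG compT compT')` by name.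

WHAT THIS DOES NOT DO.  No display, binder or statement of the skeleton is changed here (the wall keeps its `h4bC`
binder; whether a later revision drops it is the planner's RECORD/STATEMENT decision with the critics' reads); nothing
is said about the other wall binders (`hc hu hc'`, the characters; `hA`, SeesawAnisotropic p715260), nor about the bridge
`mixed_classes_pair_v3`, which stays the line's declared sorry.  Nothing here says anything about the status of the Hodge
conjecture for CM abelian varieties, which is NOT proved; HC_CM is NOT proved by anyone in this repository.
-/

set_option autoImplicit false

noncomputable section

namespace Summit.Ventures.HodgeRepro.Tier4.Line4

open Summit.Ventures.HodgeRepro.Tier4.Common Summit.Ventures.HodgeRepro.Tier4.Line1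
  Summit.Ventures.HodgeRepro.Tier4.Line1.RTF MeasureTheory Topology

section Abstract

variable {G : Type} [Group G] [TopologicalSpace G] [IsTopologicalGroup G] [MeasurableSpace G]
  [BorelSpace G]

/-- **The (4b)-closed clause is a theorem (abstract setting)**: every relatively closed invariant subspace with a
non-zero member contains a non-zero relatively closed IRREDUCIBLE invariant subspace — L4-p1's
`exists_irreducible_invariant_subspace_closed_of_nondegenerate` fed with L1-p1's rung (4a)
`kernelOp_nondegenerate` (no displayed hypothesis). -/
theorem exists_irreducible_closedSub_of_invariant [LocallyCompactSpace G] [SecondCountableTopology G]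
    (S : RTF.Setting G) (V : Set (G → ℂ)) (hV : S.IsInvariantSubspace V)
    (hclosed : ∀ ψ : G → ℂ, Continuous ψ → S.Invariant ψ →
      (∀ ε : ℝ, 0 < ε → ∃ ψ' ∈ V,
        eLpNorm (fun x => ψ x - ψ' x) 2 (S.μ.restrict S.DG) < ENNReal.ofReal ε) → ψ ∈ V)
    (hne : ∃ ψ ∈ V, ∃ x, ψ x ≠ 0) :
    ∃ V' : Set (G → ℂ), S.IsInvariantSubspace V' ∧ V' ⊆ V ∧ S.IsIrreducible V' ∧
      (∃ ψ ∈ V', ∃ x, ψ x ≠ 0) ∧ IsClosedSub S V' :=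
  exists_irreducible_invariant_subspace_closed_of_nondegenerate S V hV hclosed hne
    S.kernelOp_nondegenerate

end Abstract

section Adelic

variable {k : Type} [Field k] [NumberField k]

/-- **The wall's `h4bC` binder, BY NAME, on any setting over `G(𝔸_k)`** (`GA W`, `W : PlaneData k`): the binder of
`mixed_two_torus_W3` / `mixed_two_torus` / `l4_adaptedONB_closed` verbatim with the setting `S` free — at the wall,
`S := Setting.ofAdelicData (seesawPlane …) R μ DG fdG compG compT compT'`.  The topological instances on `GA W` are
L1-p5's `locallyCompact_GA` and `secondCountable_GA`. -/
theorem h4bC_of_setting_GA (W : PlaneData k) [MeasurableSpace (GA W)] [BorelSpace (GA W)]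
    (S : RTF.Setting (GA W)) :
    ∀ V : Set (GA W → ℂ), S.IsInvariantSubspace V →
      (∀ ψ : GA W → ℂ, Continuous ψ → S.Invariant ψ →
        (∀ ε : ℝ, 0 < ε → ∃ ψ' ∈ V,
          eLpNorm (fun x => ψ x - ψ' x) 2 (S.μ.restrict S.DG) < ENNReal.ofReal ε) → ψ ∈ V) →
      (∃ ψ ∈ V, ∃ x, ψ x ≠ 0) →
      ∃ V' : Set (GA W → ℂ), S.IsInvariantSubspace V' ∧ V' ⊆ V ∧ S.IsIrreducible V' ∧
        (∃ ψ ∈ V', ∃ x, ψ x ≠ 0) ∧ IsClosedSub S V' := by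
  haveI := locallyCompact_GA W
  haveI := secondCountable_GA W
  intro V hV hclosed hne
  exact exists_irreducible_closedSub_of_invariant S V hV hclosed hne

end Adelic

end Summit.Ventures.HodgeRepro.Tier4.Line4
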